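import Summits.HodgeConjecture.HodgeConjecture.Theorems.K2E3TypeLayerCharacters        -- ★ p855735 (this seat): the five layer-character facts on HF's data
import Summits.HodgeConjecture.HodgeConjecture.Theorems.K2E3UltrametricOrbitFiniteness   -- ★ p855343 (K2E3-p09 g0): L6 generic — `mul_norm_proj_le_of_eq_add`, `false_of_cone_near_submodule`
import HarnessLib

/-!
# Crux `H413` — K2-LIT E3 «EllipticInputs», U12-h brick (It): THE DEPTH-HALVING ENDGAME — Harish-Chandra's finiteness (Lemmas 19.3–19.4, Cor. 19.5) on abelian congruence layers,
# generic over the bricks: a `K₁`-type that OCCURS and is SELF-INTERTWINED by a point of `𝒰` is trivial on `K_{N₀}`, `N₀ = max(2ν+1, 2(H+D)+2)`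

Cell `hodgecm-mathlib`, Track B «K2-LIT», crux item `stmt-HodgeConjecture-24833` (h413), line `K2_E3_EllipticInputs`, unit U12 «HC characters», socket U12-h
`sig_K2E3CharLocConstNearRegular` (‹#9L›).  Seat K2E3-p09 (g2), 9L line lead; second half of brick (It) of memo v4 `K2/K2E3-p09/g2/MEMO-U12h-HF-bricks.v4.K2E3-p09-g2.md` (road of record =
K2E1b-p08 (g2) MEMO (H2) «depth halving» d8755e6223fd3317); `--supports stmt-HodgeConjecture-24833 --as helper`.  THEOREMS ONLY — no `def`, no named fact, no instance, no notation, no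
`sorry`.  GENERIC over the bricks: every analytic input is a hypothesis in the exact shape of the ★ brick that pays it at the frame — ★ (S) p855619 `exists_valBound_and_forall_eq_map_trace`
(hS), ★ (H-char) p855532 §§2–3 (hnd, hconjCh), ★ (H3-lite) p855559 (C) (hint), ★ (N) p855641 (hocc), ★ L6-inst p855727∕… (hL6, hcontr, hiso, hval), ★ (Fr) (the filtration `Kf`) — so that
the frame file is pure instantiation.  HONEST LABEL: HC_CM is proved only modulo the 7 printed citations (2 remaining named inputs: hLiu418 = stmt-HodgeConjecture-24832, h413 =
stmt-HodgeConjecture-24833) until rung 0 closes; count-neutral engine.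

THE MATHEMATICS ([HarishChandra1999] §19 Lemmas 19.2–19.4, Cor. 19.5, §20 pp. 84–86, with Howe's Thm. 17.1 replaced by its abelian-layer shadow; memo v4 §1).  Data: a group `G` with
operators `L : G → End W` on a finite-dimensional `k`-space (`k` algebraically closed, char. `0`), `K₁ ≤ G`, `φ : K₁ ↠ Q` finite, `τ(φ x) = L x`, an isotypic component `c` (a
`K₁`-TYPE); a filtration `Kf : ℕ → Subgroup G` (antitone, `[Kf m, Kf m′] ≤ Kf (m+m′)`, `Kf m ≤ K₁` for `m ≥ ν`, normalised by `K₁`) with `Kf M` trivial on `c`; a «parameter space»: an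
ultrametric normed `F`-space `𝔤` with `Ad : G → (𝔤 →+ 𝔤)`, characters `Ch : 𝔤 → G → k` (`Ch X = χ_X`), a cone `𝒩 ⊆ 𝔤`, and the brick hypotheses.  DEPTH `N` := least `m` with `Kf m`
trivial on `c`.  If `N > N₀` then with `N′ = ⌈N∕2⌉ ≥ ν+1`, `A := Kf N′` acts on `c` through COMMUTING operators (commutators fall in `Kf 2N′ ≤ Kf N`), and ★ p855735 yields occurring
characters `χ₁, χ₂` (INT), `χ₃` (OCC), `χ₄` (depth `N`: non-trivial on `Kf (N−1)`), all `K₁`-conjugate to `χ₁` (ONE ORBIT).  (S) gives `χ₁ = Ch X₁` on `A`; conjugates have the EXACT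
parameters `Ad(kᵢ) X₁` (hconjCh), all of norm `r = ‖X₁‖ > q^{N−1}` (hnd at `m = N−1`, hiso).  INT + (H3-lite): `(Ad y − 1)X₁ = (Ad k₂ − 1)X₁ + λ`, `‖λ‖ ≤ q^{N′+H}` ⇒ ★ L6
`mul_norm_proj_le_of_eq_add`: `c‖pq X₁‖ ≤ C max(q^{−ν} r, q^{N′+H})`; OCC + (N): `X₃ = Z + B`, `Z ∈ 𝒩`, `‖B‖ ≤ q^{N′} < r` ⇒ `‖Z‖ = r`, `‖pq Z‖ ≤ max(‖pq X₁‖, C q^{−ν} r, C q^{N′}) < ε r`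
once `C q^{−ν} < cε` and `N − 1 − N′ ≥ H + D` (`C ≤ cε q^D`) — contradicting the cone gap ★ `false_of_cone_near_submodule`.  Hence `N ≤ N₀ := max (2ν+1) (2(H+D)+2)` and `Kf N₀` is
trivial on `c`: HF's (TRIV) with `K₀ = Kf N₀`, UNIFORM in the level and the type.
* §1 `commute_on_type_of_filtration` (the layer `Kf N′` commutes on `c`), `exists_intertwiner_of_conj` (INT at `k y k⁻¹` ⇒ INT at `y`), `pow_eq_one_of_occurs`.
* §2 `lt_of_max_lt_three`-type numerics and **`false_of_parameters`** (steps (C2)–(C4) on given parameters).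
* §3 **`depthHalving`** — the endgame: OCC ∧ INT(at a `K₁`-conjugate of some `y ∈ 𝒰₀`) ⇒ `Kf N₀` trivial on `c`.

## References
* [HarishChandra1999] Harish-Chandra (notes by S. DeBacker and P. J. Sally, Jr.), *Admissible Invariant Distributions on Reductive p-adic Groups*, ULECT 16, AMS (1999): §17, §19 Lemmas
  19.2–19.4, Cor. 19.5, §20 pp. 84–86, §21.
* [Serre1977] J.-P. Serre, *Linear Representations of Finite Groups*, GTM 42 (1977): §8.1 Prop. 24.
-/

set_option autoImplicit false
-- the mandated namespace repeats `HodgeConjecture.HodgeConjecture`, as in every `Theorems/*.lean` of this sub-problem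
set_option linter.dupNamespace false

noncomputable section

open Module Set
open Summit.HodgeConjecture.HodgeConjecture.Cruxes.H413.K2E3TypeLayerCharacters
open Summit.HodgeConjecture.HodgeConjecture.Cruxes.H413.K2E3UltrametricOrbitFiniteness

namespace Summit.HodgeConjecture.HodgeConjecture.Cruxes.H413.K2E3DepthHalvingEndgame

/-! ## §1 Algebraic preliminaries on HF's data -/

section Algebra

variable {k G W Q : Type*} [Field k] [Group G] [AddCommGroup W] [Module k W] [Group Q]
  (L : G → Module.End k W) {K₁ : Subgroup G} (φ : ↥K₁ →* Q) (τ : Representation k Q W) (c : Submodule (MonoidAlgebra k Q) τ.asModule)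

/-- `L` is multiplicative on `K₁` (`L x = τ(φ x)`). [folklore] -/
theorem mul_eq (hτ : ∀ x : ↥K₁, τ (φ x) = L x) {a b : G} (ha : a ∈ K₁) (hb : b ∈ K₁) : L a * L b = L (a * b) := by
  rw [← hτ ⟨a, ha⟩, ← hτ ⟨b, hb⟩, ← hτ ⟨a * b, K₁.mul_mem ha hb⟩, ← map_mul, ← map_mul]
  rfl

/-- `L_a` (`a ∈ K₁`) preserves `c`. [folklore] -/
theorem symm_apply_mem (hτ : ∀ x : ↥K₁, τ (φ x) = L x) {a : G} (ha : a ∈ K₁) {w : W} (hw : τ.asModuleEquiv.symm w ∈ c) : τ.asModuleEquiv.symm (L a w) ∈ c := by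
  rw [← hτ ⟨a, ha⟩]
  exact (Subrepresentation.ofSubmodule' c).apply_mem_toSubmodule (φ ⟨a, ha⟩) hw

/-- **The layer `A` commutes on the type when its commutators act trivially there**: if `a b a⁻¹ b⁻¹` acts trivially on `c` for all `a, b ∈ A ≤ K₁` then `L_a L_b = L_b L_a` on `c`
(`ab = (aba⁻¹b⁻¹)(ba)`).  In the application `A = Kf N′`, `[A, A] ≤ Kf (2N′) ≤ Kf N` and `Kf N` is trivial on a type of depth `N`. [cite: HarishChandra1999, §17] -/
theorem commute_on_type_of_commutator_trivial (hτ : ∀ x : ↥K₁, τ (φ x) = L x) {A : Subgroup G} (hA : A ≤ K₁)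
    (hcomm : ∀ a ∈ A, ∀ b ∈ A, ∀ w : W, τ.asModuleEquiv.symm w ∈ c → L (a * b * a⁻¹ * b⁻¹) w = w) :
    ∀ a ∈ A, ∀ b ∈ A, ∀ w : W, τ.asModuleEquiv.symm w ∈ c → L a (L b w) = L b (L a w) := by
  intro a ha b hb w hw
  have hab : a * b = (a * b * a⁻¹ * b⁻¹) * (b * a) := by group
  rw [← Module.End.mul_apply, ← Module.End.mul_apply, mul_eq L φ τ hτ (hA ha) (hA hb), mul_eq L φ τ hτ (hA hb) (hA ha), hab,
    ← mul_eq L φ τ hτ (K₁.mul_mem (K₁.mul_mem (K₁.mul_mem (hA ha) (hA hb)) (K₁.inv_mem (hA ha))) (K₁.inv_mem (hA hb))) (K₁.mul_mem (hA hb) (hA ha)),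
    Module.End.mul_apply, hcomm a ha b hb _ (symm_apply_mem L φ τ c hτ (K₁.mul_mem (hA hb) (hA ha)) hw)]

/-- **INT at a `K₁`-conjugate gives INT at the point**: if `T` intertwines along `y = x y₀ x⁻¹` (`x ∈ K₁`) then `T′ := L_{x⁻¹} T L_x` intertwines along `y₀` (`T′ ≠ 0` on `c`, `T′(W) ⊆ c`,
`L_z T′ = T′ L_{y₀⁻¹ z y₀}` for `z ∈ K₁ ∩ y₀ K₁ y₀⁻¹`).  So HF's INT over `𝒰 = (𝒰₀)^{K₁}` reduces to INT over `𝒰₀` (where the cone estimates hold). [cite: HarishChandra1999, §19 p. 82] -/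
theorem exists_intertwiner_of_conj (hτ : ∀ x : ↥K₁, τ (φ x) = L x) {x y₀ : G} (hx : x ∈ K₁) {T : Module.End k W}
    (hTc : ∀ v, τ.asModuleEquiv.symm (T v) ∈ c) (hT0 : ∃ u, τ.asModuleEquiv.symm u ∈ c ∧ T u ≠ 0)
    (hTint : ∀ z ∈ K₁, (x * y₀ * x⁻¹)⁻¹ * z * (x * y₀ * x⁻¹) ∈ K₁ → L z * T = T * L ((x * y₀ * x⁻¹)⁻¹ * z * (x * y₀ * x⁻¹))) :
    ∃ T' : Module.End k W, (∀ v, τ.asModuleEquiv.symm (T' v) ∈ c) ∧ (∃ u, τ.asModuleEquiv.symm u ∈ c ∧ T' u ≠ 0) ∧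
      ∀ z ∈ K₁, y₀⁻¹ * z * y₀ ∈ K₁ → L z * T' = T' * L (y₀⁻¹ * z * y₀) := by
  have hx' : x⁻¹ ∈ K₁ := K₁.inv_mem hx
  have hLinv : L x⁻¹ * L x = 1 ∧ L x * L x⁻¹ = 1 := by
    constructor <;> rw [mul_eq L φ τ hτ (by assumption) (by assumption)] <;> simp only [inv_mul_cancel, mul_inv_cancel] <;>
      rw [← hτ ⟨1, K₁.one_mem⟩] <;> exact (congrArg τ (map_one φ)).trans (map_one τ)
  refine ⟨L x⁻¹ * T * L x, fun v => ?_, ?_, fun z hz hzy => ?_⟩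
  · rw [Module.End.mul_apply, Module.End.mul_apply]
    exact symm_apply_mem L φ τ c hτ hx' (hTc _)
  · obtain ⟨u, huc, hu⟩ := hT0
    refine ⟨L x⁻¹ u, symm_apply_mem L φ τ c hτ hx' huc, fun h => hu ?_⟩
    rw [Module.End.mul_apply, Module.End.mul_apply, ← Module.End.mul_apply (L x) (L x⁻¹) u, hLinv.2, Module.End.one_apply] at h
    have := congrArg (L x) h
    rwa [map_zero, ← Module.End.mul_apply, hLinv.2, Module.End.one_apply] at this
  · -- `z′ := x z x⁻¹` satisfies the hypothesis of `hTint`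
    have hz' : x * z * x⁻¹ ∈ K₁ := K₁.mul_mem (K₁.mul_mem hx hz) hx'
    have hconj : (x * y₀ * x⁻¹)⁻¹ * (x * z * x⁻¹) * (x * y₀ * x⁻¹) = x * (y₀⁻¹ * z * y₀) * x⁻¹ := by group
    have hz'y : (x * y₀ * x⁻¹)⁻¹ * (x * z * x⁻¹) * (x * y₀ * x⁻¹) ∈ K₁ := by
      rw [hconj]; exact K₁.mul_mem (K₁.mul_mem hx hzy) hx'
    have h := hTint _ hz' hz'y
    rw [hconj] at h
    -- `L_z (L_{x⁻¹} T L_x) = L_{x⁻¹} (L_{x z x⁻¹} T) L_x = L_{x⁻¹} T L_{x (y₀⁻¹ z y₀) x⁻¹} L_x = (L_{x⁻¹} T L_x) L_{y₀⁻¹ z y₀}`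
    calc L z * (L x⁻¹ * T * L x) = L x⁻¹ * (L (x * z * x⁻¹) * T) * L x := by
          rw [← mul_eq L φ τ hτ (K₁.mul_mem hx hz) hx', ← mul_eq L φ τ hτ hx hz]
          simp only [← mul_assoc, hLinv.1, one_mul]
      _ = L x⁻¹ * (T * L (x * (y₀⁻¹ * z * y₀) * x⁻¹)) * L x := by rw [h]
      _ = L x⁻¹ * T * L x * L (y₀⁻¹ * z * y₀) := by
          rw [← mul_eq L φ τ hτ (K₁.mul_mem hx hzy) hx', ← mul_eq L φ τ hτ hx hzy]
          simp only [mul_assoc, hLinv.1, mul_one]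

/-- An occurring character takes values of finite order on the layer: `χ(a)^{|Q|} = 1` (`L_a^{|Q|} = 1`). [folklore] -/
theorem pow_eq_one_of_occurs (hτ : ∀ x : ↥K₁, τ (φ x) = L x) {A : Subgroup G} (hA : A ≤ K₁) {χ : G → k} {w : W} (hw0 : w ≠ 0) (hχ : ∀ a ∈ A, L a w = χ a • w)
    {a : G} (ha : a ∈ A) : χ a ^ Nat.card Q = 1 := by
  have h1 : ∀ n : ℕ, (L a ^ n) w = χ a ^ n • w := fun n => by
    induction n with
    | zero => rw [pow_zero, pow_zero, Module.End.one_apply, one_smul]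
    | succ n ih => rw [pow_succ, Module.End.mul_apply, hχ a ha, map_smul, ih, smul_smul, pow_succ']
  have h2 := h1 (Nat.card Q)
  rw [pow_card_eq_one_of_mem L φ τ hτ hA ⟨a, ha⟩, Module.End.one_apply] at h2
  exact (smul_left_injective k hw0 (show (1 : k) • w = χ a ^ Nat.card Q • w by rw [one_smul]; exact h2)).symm

end Algebra

/-! ## §2 The analytic endgame on given parameters (HC Lemma 19.4 ∕ Cor. 19.5 ∕ Lemma 19.3 with `V = ∅`) -/

section Analytic

variable {F 𝔤 : Type*} [NormedField F] [NormedAddCommGroup 𝔤] [NormedSpace F 𝔤] [IsUltrametricDist 𝔤]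

/-- **STEPS (C2)–(C4) ON GIVEN PARAMETERS.**  `pq` («`p_𝔮`»), `Ty` («`Ad(y) − 1`»), `Ak` («`Ad(k₂) − 1`») as in ★ L6; `X₁` the INT-parameter with `Ty X₁ = Ak X₁ + λ` (`‖λ‖ ≤ ℓ`), `X₃` the
OCC-parameter in the same orbit (`‖X₃ − X₁‖ ≤ δ‖X₁‖`, `‖X₃‖ = ‖X₁‖`) with `X₃ = Z + B`, `Z` in the cone `𝒩`, `‖B‖ ≤ b < ‖X₁‖`; numerics `Cδ < cε`, `Cδ < ε`, `Cℓ < cε‖X₁‖`, `Cb < ε‖X₁‖`.  Then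
`‖pq Z‖ < ε‖Z‖` while `Z − pq Z ∈ 𝔱` — impossible by the cone gap (★ `false_of_cone_near_submodule`). [cite: HarishChandra1999, Lemma 19.4, Cor. 19.5, Lemma 19.3] -/
theorem false_of_parameters {𝒩 : Set 𝔤} (h𝒩 : ∀ (a : F) (Y : 𝔤), Y ∈ 𝒩 → a • Y ∈ 𝒩) (pq Ty Ak : 𝔤 →+ 𝔤) (𝔱 : Submodule F 𝔤) {cst C ε δ ℓ b : ℝ}
    (hcst : 0 < cst) (hC : 0 ≤ C) (hb0 : 0 ≤ b) (hker : ∀ X, X - pq X ∈ 𝔱) (hcomm : ∀ X, pq (Ty X) = Ty (pq X))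
    (hT : ∀ X, cst * ‖pq X‖ ≤ ‖Ty (pq X)‖) (hpq : ∀ X, ‖pq X‖ ≤ C * ‖X‖) (hsep : ∀ Y ∈ 𝒩, ‖Y‖ = 1 → ∀ Z ∈ 𝔱, ε ≤ ‖Y - Z‖)
    (hval : ∀ Y : 𝔤, Y ≠ 0 → ∃ a : F, a ≠ 0 ∧ ‖Y‖ = ‖a‖) (hAk : ∀ X, ‖Ak X‖ ≤ δ * ‖X‖)
    {X₁ X₃ Z B lam : 𝔤} (h1 : Ty X₁ = Ak X₁ + lam) (hlam : ‖lam‖ ≤ ℓ) (h31 : ‖X₃ - X₁‖ ≤ δ * ‖X₁‖) (hr : ‖X₃‖ = ‖X₁‖)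
    (hZB : X₃ = Z + B) (hZ : Z ∈ 𝒩) (hB : ‖B‖ ≤ b)
    (hδ : C * δ < cst * ε) (hδ' : C * δ < ε) (hℓ : C * ℓ < cst * ε * ‖X₁‖) (hb : C * b < ε * ‖X₁‖) (hbr : b < ‖X₁‖) : False := by
  have hr0 : 0 < ‖X₁‖ := hb0.trans_lt hbr
  -- (C2) `‖pq X₁‖ < ε ‖X₁‖`
  have hpq1 : cst * ‖pq X₁‖ ≤ C * max (δ * ‖X₁‖) ℓ := mul_norm_proj_le_of_eq_add pq Ty Ak hcomm hC hT hpq hAk hlam h1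
  have hpq1' : ‖pq X₁‖ < ε * ‖X₁‖ := by
    have hlt : C * max (δ * ‖X₁‖) ℓ < cst * (ε * ‖X₁‖) := by
      rw [mul_max_of_nonneg _ _ hC]
      refine max_lt ?_ ?_
      · calc C * (δ * ‖X₁‖) = C * δ * ‖X₁‖ := by ring
          _ < cst * ε * ‖X₁‖ := mul_lt_mul_of_pos_right hδ hr0
          _ = cst * (ε * ‖X₁‖) := by ring
      · calc C * ℓ < cst * ε * ‖X₁‖ := hℓ
          _ = cst * (ε * ‖X₁‖) := by ring
    exact lt_of_mul_lt_mul_left (hpq1.trans_lt hlt) hcst.le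
  -- transfer along the orbit to `X₃`
  have hpq3 : ‖pq X₃‖ < ε * ‖X₁‖ := by
    have h : pq X₃ = pq X₁ + pq (X₃ - X₁) := by rw [map_sub, add_sub_cancel]
    rw [h]
    refine (IsUltrametricDist.norm_add_le_max _ _).trans_lt (max_lt hpq1' ?_)
    calc ‖pq (X₃ - X₁)‖ ≤ C * ‖X₃ - X₁‖ := hpq _
      _ ≤ C * (δ * ‖X₁‖) := mul_le_mul_of_nonneg_left h31 hC
      _ = C * δ * ‖X₁‖ := by ring
      _ < ε * ‖X₁‖ := mul_lt_mul_of_pos_right hδ' hr0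
  -- (C3)–(C4): `Z = X₃ − B` has norm `‖X₁‖` and small `𝔮`-part
  have hZeq : Z = X₃ - B := by rw [hZB, add_sub_cancel_right]
  have hZnorm : ‖Z‖ = ‖X₁‖ := by
    rw [hZeq, norm_sub_proj_eq_of_norm_proj_lt (hB.trans_lt (hbr.trans_eq hr.symm)), hr]
  have hpqZ : ‖pq Z‖ < ε * ‖X₁‖ := by
    rw [hZeq, map_sub]
    have hsub : ‖pq X₃ - pq B‖ ≤ max ‖pq X₃‖ ‖pq B‖ := by
      simpa only [sub_eq_add_neg, norm_neg] using IsUltrametricDist.norm_add_le_max (pq X₃) (-(pq B))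
    refine hsub.trans_lt (max_lt hpq3 ?_)
    calc ‖pq B‖ ≤ C * ‖B‖ := hpq _
      _ ≤ C * b := mul_le_mul_of_nonneg_left hB hC
      _ < ε * ‖X₁‖ := hb
  have hZ0 : Z ≠ 0 := by
    intro h
    rw [h, norm_zero] at hZnorm
    exact hr0.ne hZnorm
  obtain ⟨a, ha, hZa⟩ := hval Z hZ0
  refine false_of_cone_near_submodule h𝒩 𝔱 hsep ha hZ hZa (hker Z) ?_
  rw [← hZa, hZnorm, sub_sub_cancel_left, norm_neg]
  exact hpqZ

end Analytic

/-! ## §3 The depth-halving theorem -/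

section DepthHalving

universe uQ

variable {k G W : Type*} {Q : Type uQ} [Field k] [IsAlgClosed k] [CharZero k] [Group G] [AddCommGroup W] [Module k W] [FiniteDimensional k W] [Group Q] [Finite Q]
  {F 𝔤 : Type*} [NormedField F] [NormedAddCommGroup 𝔤] [NormedSpace F 𝔤] [IsUltrametricDist 𝔤]

/-- **THE DEPTH-HALVING ENDGAME (Harish-Chandra's finiteness at a regular point, abelian-layer form).**  HF's data `(W, L, K₁, Q, φ, τ, c)`; a filtration `Kf` (antitone, commutator-additive,
normalised by `K₁`, inside `K₁` from `ν` on) with `Kf M` trivial on `c`; a parameter theory `(𝔤, Ad, Ch, 𝒩)` satisfying the brick hypotheses (S) `hS`, (H-char) `hnd`∕`hconjCh`,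
(H3-lite) `hint` (uniform `H` on `𝒰₀`), (N) `hocc` (w.r.t. the occurrence level `Kf ν′`), L6-inst `hL6` (cone data for every `y ∈ 𝒰₀`, constants `cst ≤ 1`, `C`, `ε`), contraction `hcontr` and isometry
`hiso` on `K₁`, norm values `hval`; numerics `C (q^ν)⁻¹ < cst·ε` and `C ≤ cst·ε·q^D`.  THEN: if the type OCCURS (a non-zero vector of `c` fixed by `K₁ ∩ x (Kf ν′) x⁻¹`) and is
SELF-INTERTWINED by a `K₁`-conjugate of some `y ∈ 𝒰₀`, every element of `Kf N₀`, `N₀ = max (2ν+1) (2(H+D)+2)`, acts trivially on `c` — HF's (TRIV), uniformly in the level and the type.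
[cite: HarishChandra1999, §19 Lemmas 19.3–19.4, Cor. 19.5, §20 pp. 84–86] [cite: Serre1977, §8.1 Prop. 24] -/
theorem depthHalving (L : G → Module.End k W) {K₁ : Subgroup G} (φ : ↥K₁ →* Q) (hφ : Function.Surjective φ) (τ : Representation k Q W)
    (hτ : ∀ x : ↥K₁, τ (φ x) = L x) {c : Submodule (MonoidAlgebra k Q) τ.asModule} (hc : c ∈ isotypicComponents (MonoidAlgebra k Q) τ.asModule)
    -- the filtration
    (Kf : ℕ → Subgroup G) (hanti : ∀ m m', m ≤ m' → Kf m' ≤ Kf m) (hcommf : ∀ m m', ∀ a ∈ Kf m, ∀ b ∈ Kf m', a * b * a⁻¹ * b⁻¹ ∈ Kf (m + m'))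
    (hnormf : ∀ m, ∀ x ∈ K₁, ∀ a ∈ Kf m, x * a * x⁻¹ ∈ Kf m) (ν : ℕ) (hKfle : ∀ m, ν ≤ m → Kf m ≤ K₁)
    (M : ℕ) (hM : ∀ a ∈ Kf M, ∀ w : W, τ.asModuleEquiv.symm w ∈ c → L a w = w)
    -- the parameter theory
    (q : ℝ) (hq : 1 < q) (Ad : G → 𝔤 →+ 𝔤) (Ch : 𝔤 → G → k) (𝒩 : Set 𝔤) (h𝒩 : ∀ (a : F) (Y : 𝔤), Y ∈ 𝒩 → a • Y ∈ 𝒩)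
    (hS : ∀ N' N : ℕ, 1 ≤ N' → ν ≤ N' → N' ≤ N → N ≤ 2 * N' → ∀ χ : G → k,
      (∀ a ∈ Kf N', ∀ b ∈ Kf N', χ (a * b) = χ a * χ b) → (∀ a ∈ Kf N, χ a = 1) → (∀ a ∈ Kf N', ∃ n : ℕ, 0 < n ∧ χ a ^ n = 1) →
      ∃ X : 𝔤, ‖X‖ ≤ q ^ N ∧ ∀ a ∈ Kf N', χ a = Ch X a)
    (hnd : ∀ m : ℕ, 1 ≤ m → ∀ X : 𝔤, (∀ a ∈ Kf m, Ch X a = 1) ↔ ‖X‖ ≤ q ^ m)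
    (hconjCh : ∀ x : G, ∀ X : 𝔤, ∀ a : G, Ch X (x⁻¹ * a * x) = Ch (Ad x X) a)
    (hiso : ∀ x ∈ K₁, ∀ X : 𝔤, ‖Ad x X‖ = ‖X‖) (hcontr : ∀ x ∈ K₁, ∀ X : 𝔤, ‖Ad x X - X‖ ≤ (q ^ ν)⁻¹ * ‖X‖)
    (𝒰₀ : Set G) (H : ℕ)
    (hint : ∀ y ∈ 𝒰₀, ∀ m : ℕ, 1 ≤ m → ∀ X X' : 𝔤, (∀ a ∈ Kf m, y⁻¹ * a * y ∈ Kf m → Ch X (y⁻¹ * a * y) = Ch X' a) → ‖Ad y X - X'‖ ≤ q ^ (m + H))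
    (ν' : ℕ)
    (hocc : ∀ N' : ℕ, ν ≤ N' → ∀ X : 𝔤, ∀ x : G, (∀ a ∈ Kf N', x⁻¹ * a * x ∈ Kf ν' → Ch X a = 1) → ∃ Z B : 𝔤, Z ∈ 𝒩 ∧ ‖B‖ ≤ q ^ N' ∧ X = Z + B)
    {cst C ε : ℝ} (hcst : 0 < cst) (hcst1 : cst ≤ 1) (hC : 0 ≤ C) (hε : 0 < ε)
    (hL6 : ∀ y ∈ 𝒰₀, ∃ (pq : 𝔤 →+ 𝔤) (𝔱 : Submodule F 𝔤), (∀ X, X - pq X ∈ 𝔱) ∧ (∀ X, pq (Ad y X) = Ad y (pq X)) ∧ (∀ X, cst * ‖pq X‖ ≤ ‖Ad y (pq X) - pq X‖) ∧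
      (∀ X, ‖pq X‖ ≤ C * ‖X‖) ∧ (∀ Y ∈ 𝒩, ‖Y‖ = 1 → ∀ Z ∈ 𝔱, ε ≤ ‖Y - Z‖))
    (hval : ∀ Y : 𝔤, Y ≠ 0 → ∃ a : F, a ≠ 0 ∧ ‖Y‖ = ‖a‖)
    (D : ℕ) (hD : C ≤ cst * ε * q ^ D) (hνC : C * (q ^ ν)⁻¹ < cst * ε)
    -- OCC and INT
    (hOCC : ∃ (x : G) (w : W), τ.asModuleEquiv.symm w ∈ c ∧ w ≠ 0 ∧ ∀ z ∈ K₁, x⁻¹ * z * x ∈ Kf ν' → L z w = w)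
    (hINT : ∃ y ∈ 𝒰₀, ∃ x ∈ K₁, ∃ T : Module.End k W, (∀ v, τ.asModuleEquiv.symm (T v) ∈ c) ∧ (∃ u, τ.asModuleEquiv.symm u ∈ c ∧ T u ≠ 0) ∧
      ∀ z ∈ K₁, (x * y * x⁻¹)⁻¹ * z * (x * y * x⁻¹) ∈ K₁ → L z * T = T * L ((x * y * x⁻¹)⁻¹ * z * (x * y * x⁻¹))) :
    ∀ a ∈ Kf (max (2 * ν + 1) (2 * (H + D) + 2)), ∀ w : W, τ.asModuleEquiv.symm w ∈ c → L a w = w := by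
  classical
  -- the depth `N`
  have hex : ∃ m, ∀ a ∈ Kf m, ∀ w : W, τ.asModuleEquiv.symm w ∈ c → L a w = w := ⟨M, hM⟩
  set N := Nat.find hex with hNdef
  have hPN : ∀ a ∈ Kf N, ∀ w : W, τ.asModuleEquiv.symm w ∈ c → L a w = w := Nat.find_spec hex
  set N₀ := max (2 * ν + 1) (2 * (H + D) + 2) with hN₀
  by_cases hle : N ≤ N₀
  · exact fun a ha w hw => hPN a (hanti N N₀ hle ha) w hw
  exfalso
  push Not at hle
  -- numerology of `N′ = ⌈N/2⌉`
  set N' := (N + 1) / 2 with hN'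
  have hN3 : 3 ≤ N := by omega
  have hN'1 : 1 ≤ N' := by omega
  have hνN' : ν ≤ N' := by omega
  have hN'N : N' ≤ N - 1 := by omega
  have hN2 : N ≤ 2 * N' := by omega
  have hgap : N' + H + D ≤ N - 1 := by omega
  -- the layer `A = Kf N′` and its commutativity on `c`
  have hA : Kf N' ≤ K₁ := hKfle N' hνN'
  have hcommA : ∀ a ∈ Kf N', ∀ b ∈ Kf N', ∀ w : W, τ.asModuleEquiv.symm w ∈ c → L a (L b w) = L b (L a w) :=
    commute_on_type_of_commutator_trivial L φ τ c hτ hA fun a ha b hb w hw =>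
      hPN _ (hanti N (N' + N') (by omega) (hcommf N' N' a ha b hb)) w hw
  -- depth witness: `Kf (N−1)` acts non-trivially
  have hnot : ¬ ∀ a ∈ Kf (N - 1), ∀ w : W, τ.asModuleEquiv.symm w ∈ c → L a w = w := by
    have h := Nat.find_min hex (show N - 1 < N by omega)
    exact h
  push Not at hnot
  obtain ⟨a₄, ha₄, w₄, hw₄c, hw₄⟩ := hnot
  have ha₄A : a₄ ∈ Kf N' := hanti N' (N - 1) hN'N ha₄
  -- the four occurring characters
  obtain ⟨y, hy, xI, hxI, T, hTc, hT0, hTint⟩ := hINT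
  obtain ⟨T', hT'c, hT'0, hT'int⟩ := exists_intertwiner_of_conj L φ τ c hτ hxI hTc hT0 hTint
  obtain ⟨χ₁, χ₂, hχ₁, hχ₂, h12⟩ := exists_occurs_pair_of_intertwiner L φ τ c hτ hA hcommA hT'c hT'0 hT'int
  obtain ⟨xO, wO, hwOc, hwO0, hwOfix⟩ := hOCC
  obtain ⟨χ₃, hχ₃, h3⟩ := exists_occurs_trivial_of_fixed L φ τ c hτ hA hcommA hwOc hwO0 hwOfix
  obtain ⟨χ₄, hχ₄, h4⟩ := exists_occurs_ne_one_of_ne L φ τ c hτ hA hcommA ha₄A ⟨w₄, hw₄c, hw₄⟩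
  obtain ⟨k₂, hk₂, hk₂χ⟩ := exists_conj_of_occurs_of_occurs L φ τ c hτ hφ hA (hnormf N') hc hcommA hχ₁ hχ₂
  obtain ⟨k₃, hk₃, hk₃χ⟩ := exists_conj_of_occurs_of_occurs L φ τ c hτ hφ hA (hnormf N') hc hcommA hχ₁ hχ₃
  obtain ⟨k₄, hk₄, hk₄χ⟩ := exists_conj_of_occurs_of_occurs L φ τ c hτ hφ hA (hnormf N') hc hcommA hχ₁ hχ₄
  -- the parameter `X₁` of `χ₁`
  obtain ⟨w₁, hw₁c, hw₁0, hw₁⟩ := hχ₁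
  obtain ⟨X₁, hX₁N, hX₁⟩ := hS N' N hN'1 hνN' (by omega) hN2 χ₁
    (fun a ha b hb => apply_mul_eq_of_occurs L φ τ hτ hA hw₁0 hw₁ ha hb)
    (fun a ha => apply_eq_one_of_occurs_of_forall L τ c hw₁c hw₁0 hw₁ (hanti N' N (by omega) ha) fun v hv => hPN a ha v hv)
    (fun a ha => ⟨Nat.card Q, Nat.card_pos, pow_eq_one_of_occurs L φ τ hτ hA hw₁0 hw₁ ha⟩)
  -- conjugate parameters are exact: `χᵢ = Ch (Ad kᵢ X₁)` on `A`
  have hnormf' : ∀ x ∈ K₁, ∀ a ∈ Kf N', x⁻¹ * a * x ∈ Kf N' := fun x hx a ha => by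
    have := hnormf N' x⁻¹ (K₁.inv_mem hx) a ha
    rwa [inv_inv] at this
  have hX₂ : ∀ a ∈ Kf N', χ₂ a = Ch (Ad k₂ X₁) a := fun a ha => by rw [hk₂χ a ha, hX₁ _ (hnormf' k₂ hk₂ a ha), hconjCh]
  have hX₃ : ∀ a ∈ Kf N', χ₃ a = Ch (Ad k₃ X₁) a := fun a ha => by rw [hk₃χ a ha, hX₁ _ (hnormf' k₃ hk₃ a ha), hconjCh]
  have hX₄ : ∀ a ∈ Kf N', χ₄ a = Ch (Ad k₄ X₁) a := fun a ha => by rw [hk₄χ a ha, hX₁ _ (hnormf' k₄ hk₄ a ha), hconjCh]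
  -- depth lower bound: `‖X₁‖ > q^(N−1)`
  have hq0 : 0 < q := zero_lt_one.trans hq
  have hq1 : 1 ≤ q := hq.le
  have hr : q ^ (N - 1) < ‖X₁‖ := by
    by_contra hle'
    push Not at hle'
    have hX₄le : ‖Ad k₄ X₁‖ ≤ q ^ (N - 1) := by rw [hiso k₄ hk₄]; exact hle'
    have htriv := (hnd (N - 1) (by omega) (Ad k₄ X₁)).2 hX₄le a₄ ha₄
    exact h4 (by rw [hX₄ a₄ ha₄A]; exact htriv)
  -- INT: `‖Ad y X₁ − Ad k₂ X₁‖ ≤ q^(N′+H)`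
  have hlam : ‖Ad y X₁ - Ad k₂ X₁‖ ≤ q ^ (N' + H) := by
    refine hint y hy N' hN'1 X₁ (Ad k₂ X₁) fun a ha hya => ?_
    rw [← hX₁ _ hya, ← hX₂ a ha]
    exact (h12 a ha hya).symm
  -- OCC: `Ad k₃ X₁ = Z + B`
  obtain ⟨Z, B, hZ, hB, hZB⟩ := hocc N' hνN' (Ad k₃ X₁) xO fun a ha hxa => by rw [← hX₃ a ha]; exact h3 a ha hxa
  -- the cone data at `y`
  obtain ⟨pq, 𝔱, hker, hcomm, hT, hpq, hsep⟩ := hL6 y hy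
  -- numerics
  have hqpow : ∀ {m m' : ℕ}, m ≤ m' → q ^ m ≤ q ^ m' := fun h => pow_le_pow_right₀ hq1 h
  have hε' : 0 < cst * ε := mul_pos hcst hε
  have hℓ : C * q ^ (N' + H) < cst * ε * ‖X₁‖ := by
    calc C * q ^ (N' + H) ≤ cst * ε * q ^ D * q ^ (N' + H) := mul_le_mul_of_nonneg_right hD (pow_nonneg hq0.le _)
      _ = cst * ε * q ^ (D + (N' + H)) := by rw [pow_add]; ring
      _ ≤ cst * ε * q ^ (N - 1) := mul_le_mul_of_nonneg_left (hqpow (by omega)) hε'.le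
      _ < cst * ε * ‖X₁‖ := mul_lt_mul_of_pos_left hr hε'
  have hCε : C ≤ ε * q ^ D := by
    calc C ≤ cst * ε * q ^ D := hD
      _ ≤ 1 * ε * q ^ D := by gcongr
      _ = ε * q ^ D := by rw [one_mul]
  have hb : C * q ^ N' < ε * ‖X₁‖ := by
    calc C * q ^ N' ≤ ε * q ^ D * q ^ N' := mul_le_mul_of_nonneg_right hCε (pow_nonneg hq0.le _)
      _ = ε * q ^ (D + N') := by rw [pow_add]; ring
      _ ≤ ε * q ^ (N - 1) := mul_le_mul_of_nonneg_left (hqpow (by omega)) hε.le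
      _ < ε * ‖X₁‖ := mul_lt_mul_of_pos_left hr hε
  have hbr : q ^ N' < ‖X₁‖ := (hqpow (by omega)).trans_lt hr
  have hδ' : C * (q ^ ν)⁻¹ < ε := by
    calc C * (q ^ ν)⁻¹ < cst * ε := hνC
      _ ≤ 1 * ε := by gcongr
      _ = ε := one_mul ε
  -- assemble ★ L6 through `false_of_parameters`
  refine false_of_parameters h𝒩 pq (Ad y - AddMonoidHom.id 𝔤) (Ad k₂ - AddMonoidHom.id 𝔤) 𝔱 hcst hC (pow_nonneg hq0.le N') hker (fun X => ?_) (fun X => ?_) hpq hsep hval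
    (fun X => hcontr k₂ hk₂ X) (X₁ := X₁) (X₃ := Ad k₃ X₁) (lam := Ad y X₁ - Ad k₂ X₁) ?_ hlam ?_ (hiso k₃ hk₃ X₁) hZB hZ hB hνC hδ' hℓ hb hbr
  · -- `pq` commutes with `Ad y − 1`
    simp only [AddMonoidHom.sub_apply, AddMonoidHom.id_apply, map_sub, hcomm]
  · -- the cone estimate for `Ad y − 1`
    simpa only [AddMonoidHom.sub_apply, AddMonoidHom.id_apply] using hT X
  · -- `(Ad y − 1) X₁ = (Ad k₂ − 1) X₁ + λ`
    simp only [AddMonoidHom.sub_apply, AddMonoidHom.id_apply]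
    abel
  · exact hcontr k₃ hk₃ X₁

end DepthHalving

end Summit.HodgeConjecture.HodgeConjecture.Cruxes.H413.K2E3DepthHalvingEndgame

end
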